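import Summits.ResolutionOfSingularities.ResolutionOfSingularities.Theorems.MarkedTransferCampaignW46ThreefoldsGammaFreeGlobal
import HarnessLib

/-!
# [OURS · L1 W4.6 rung (ii)] THE DIMENSION LADDER of the Γ-free global order-reduction statement —
# `CampaignW46.OrderReducible I m` and `CampaignW46.GammaFreeGlobalOrderReductionDimLE p d` (statement-only typing + nesting)

Everything here is OURS: campaign DEFINITIONS over the W4.6 rung-(ii) module `…ThreefoldsGammaFreeGlobal.lean`
(`CampaignW46.IsPermissibleBlowupSeq`, `CampaignW46.GammaFreeGlobalOrderReductionDimLeThree p`, res-L1-type-o1 p493059,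
OURS-desk #96 CONCORDANT) plus pure-logic nesting lemmas. Nothing here is a statement of Hironaka's manuscript, no typed
`Hironaka2017` candidate enters, no `Literature.…` FACT is used. Typed by res-L1-type-o1 (OURS typer o1, gen 6,
2026-08-27) as the object NAMED for the tranche-1 rung-(ii) provers res-L1-s46-pv-10 / pv-11 (res-plan-2 §1i
2026-08-27T04:09:11Z: «rung (ii) global GammaFree — provers take the proof content the typer names»; typer's RUNG MAP
`run/shared/lean/pub/res-hironaka/L/res-L1-type-o1/RUNG-MAP-W46.md`). Host: MarkedTransfer
`HypersurfaceOrderReductionDimLeThree` (stmt-ResolutionOfSingularities-16156), `--supports … --as helper`; this module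
is ROUTE-INDEPENDENT (no `Theses/…` import, directly or transitively).

WHAT IS TYPED
* `CampaignW46.OrderReducible I m` — the CONCLUSION of the rung-(ii) statement of record read on ONE input `(X, I, m)`:
  «there is a sequence of permissible blowing-ups `Φ : X′ → X` for `(I, m)` (`IsPermissibleBlowupSeq`) whose last transform
  has order `< m` at every point of `X′`» — so that provers can state per-input lemmas (curves, surfaces, one blow-up
  step) without repeating the eleven binders; anchors `OrderReducible.of_forall_lt` (the empty sequence) and
  `OrderReducible.of_blowup` (one permissible blowing-up followed by order reduction of the transform — the induction step
  every proof uses), both pure plumbing over the two constructors `nil` / `blowup` and `comp`.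
* `CampaignW46.GammaFreeGlobalOrderReductionDimLE p d` — the statement of record with the dimension bound `3` replaced by
  the parameter `d` (binders otherwise byte-identical, conclusion spelled `OrderReducible I m`):
  `gammaFreeGlobalOrderReductionDimLE_three_iff` (`d = 3` ↔ the statement of record) and antitonicity
  `GammaFreeGlobalOrderReductionDimLE.of_le` (`d ≤ d′ →` rung `d′` ⇒ rung `d`). RUNGS NAMED FOR THE PROVERS (RUNG MAP
  (ii-1)/(ii-2)): `d = 1` (regular integral CURVES: closed points are effective Cartier divisors, permissible steps are
  identities `IsBlowup.id`, the controlled transform divides by `𝓘_D^m` — res-L1-s46-pv-10) and `d = 2` (regular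
  SURFACES: existential order reduction of an effective Cartier ideal by blowing up closed points / regular curve
  components of the order-`≥ m` locus — res-L1-s46-pv-11, sharing its local algebra with rung (i-a)′); `d = 3` is the
  statement of record (not a tranche-1 deliverable: it needs the résumés of a named notion instance, RUNG MAP (ii-3)).

VACUITY / STRENGTH SELF-CHECK (typer). `OrderReducible I m`: not trivially true for the inputs of the ladder (as for the
statement of record: without `restrict` no stage can become empty — every centre is nowhere dense because `ord_η I = 0 <
m` at the generic point — so truth requires genuine order reduction above every point of `X`); trivially true exactly
when `ord_x I < m` everywhere already (`of_forall_lt`), in particular for `I = ⊤`. `GammaFreeGlobalOrderReductionDimLE p d`: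
`d = 0` IS TRIVIALLY INHABITED and is disclosed as the warm-up slice (an integral regular `k`-scheme of dimension `0`
with `I ≠ ⊥` effective Cartier has `I = ⊤`, so `ord ≡ 0 < m` and the empty sequence works) — it is NOT one of the named
rungs; `d = 1, 2` are contentful (e.g. `X = 𝔸¹_k`, `I = (x^m·(x-1)^m)`, resp. a plane curve of multiplicity `≥ m`); for
`d ≥ 3` the rung implies the statement of record (`of_le`), which is implied by the host item (calibration leaf
`…GammaFreeGlobalCalibration.lean`) and open in the tree. Not trivially false at any `d` (true classically for `d ≤ 3`).

AI-WRITTEN; NO expert review; AI review is weaker than expert review. H. Hironaka, ms. 2017-03-23, §2.1 p.4, Def. 2.1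
p.5, Def. 2.4 p.6, Th. 16.13 p.87 — scope only, under adjudication, not cited as fact. [Hironaka2017]
References: `…ThreefoldsGammaFreeGlobal.lean` (imported; statement of record and `IsPermissibleBlowupSeq`), tree
`Literature/AlgebraicGeometry/Resolution/Blowups.lean` (`IsBlowup.id`, `IsBlowup.isIso` — pointers for the `d = 1` rung,
not imported).
-/

noncomputable section

set_option linter.dupNamespace false -- mandated namespace of this single-conjunct summit

open CategoryTheory AlgebraicGeometry TopologicalSpace

namespace Summit.ResolutionOfSingularities.ResolutionOfSingularities.Theorems

namespace CampaignW46

open Literature.AlgebraicGeometry.Resolution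
open Scheme.IdealSheafData
open Literature.AlgebraicGeometry.Hironaka2017

universe u

/-! ## §1 The conclusion on one input -/

/-- [OURS · L1 W4.6 rung (ii)] replaces the role of the CONCLUSION of the rung-(ii) statement of record
(`GammaFreeGlobalOrderReductionDimLeThree p`, itself replacing the role of «the typed Th. 16.6 procedure reduces order
where MarkedTransfer `HypersurfaceOrderReductionDimLeThree` applies», Th. 16.13 / 16.14 p.87 l.26–35 scope only) READ ON
ONE INPUT `(X, I, m)`; NOT a statement of the manuscript. **`(X, I, m)` IS ORDER-REDUCIBLE BY PERMISSIBLE BLOWING-UPS**: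
there are a scheme `X′`, a morphism `Φ : X′ ⟶ X` and an ideal `J′` on `X′` such that `Φ, J′` is a sequence of permissible
blowing-ups for `(I, m)` (`IsPermissibleBlowupSeq I m Φ J′`: regular centres inside the successive loci of order `≥ m` of
the WHOLE stages, controlled transforms with exponent `m`, no localisation) and `ord_x J′ < m` at every `x : X′`.
VACUITY: module docstring. [folklore] -/
def OrderReducible {X : Scheme.{u}} (I : X.IdealSheafData) (m : ℕ) : Prop :=
  ∃ (X' : Scheme.{u}) (Φ : X' ⟶ X) (J' : X'.IdealSheafData),
    IsPermissibleBlowupSeq I m Φ J' ∧ ∀ x : X', idealOrder J' x < m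

namespace OrderReducible

variable {X : Scheme.{u}} {I : X.IdealSheafData} {m : ℕ}

/-- Pure logic (the empty sequence `IsPermissibleBlowupSeq.nil`): an input whose order is already `< m` everywhere is
order-reducible, by `X′ = X`, `Φ = 𝟙`, `J′ = I`. [folklore] -/
theorem of_forall_lt (h : ∀ x : X, idealOrder I x < m) : OrderReducible I m :=
  ⟨X, 𝟙 X, I, IsPermissibleBlowupSeq.nil, h⟩

/-- Pure logic (the constructors `single` / `comp`): **the induction step** — if `π : X′ ⟶ X` is the blowing up of `X`
along a regular centre `D` inside the locus of order `≥ m` of `I`, and the controlled transform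
`controlledTransform π 𝓘_D I m` on `X′` is order-reducible (for the same `m`), then `(X, I, m)` is order-reducible.
[folklore] -/
theorem of_blowup {X' : Scheme.{u}} (D : Closeds X) (π : X' ⟶ X)
    (hreg : Scheme.IsRegular (vanishingIdeal D).subscheme)
    (hD : ∀ y ∈ (D : Set X), (m : ℕ∞) ≤ idealOrder I y) (hπ : IsBlowup π (vanishingIdeal D))
    (h : OrderReducible (controlledTransform π (vanishingIdeal D) I m) m) : OrderReducible I m := by
  obtain ⟨X'', τ, J'', hseq, hlt⟩ := h
  exact ⟨X'', τ ≫ π, J'', (IsPermissibleBlowupSeq.single D π hreg hD hπ).comp hseq, hlt⟩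

/-- Pure logic (`comp`): order-reducibility may be reached through ANY sequence of permissible blowing-ups whose last
transform is order-reducible. [folklore] -/
theorem of_isPermissibleBlowupSeq {X' : Scheme.{u}} {σ : X' ⟶ X} {J' : X'.IdealSheafData}
    (hσ : IsPermissibleBlowupSeq I m σ J') (h : OrderReducible J' m) : OrderReducible I m := by
  obtain ⟨X'', τ, J'', hseq, hlt⟩ := h
  exact ⟨X'', τ ≫ σ, J'', hσ.comp hseq, hlt⟩

end OrderReducible

/-- Pure logic: the statement of record, conclusion spelled `OrderReducible`. [folklore] -/
theorem gammaFreeGlobalOrderReductionDimLeThree_iff_orderReducible (p : ℕ) :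
    GammaFreeGlobalOrderReductionDimLeThree.{u} p ↔
      (p.Prime → ∀ (k : Type u) [Field k] [CharP k p] [PerfectField k] (X : Scheme.{u}) (s : X ⟶ Spec (.of k)),
        IsSeparated s → LocallyOfFiniteType s → QuasiCompact s → IsIntegral X → Scheme.IsRegular X →
          topologicalKrullDim X ≤ 3 → ∀ (I : X.IdealSheafData), I ≠ ⊥ → IsEffectiveCartier I → ∀ (m : ℕ), 1 ≤ m →
            OrderReducible I m) :=
  Iff.rfl

/-! ## §2 The dimension ladder -/

/-- [OURS · L1 W4.6 rung (ii)] replaces the role of «(ii) threefold hypersurfaces: the typed Th. 16.6 procedure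
terminates — and reduces order — where MarkedTransfer `HypersurfaceOrderReductionDimLeThree` applies» (RESCUE-SEED W4.6
(ii); Th. 16.13 / 16.14 p.87 l.26–35 scope only) AS A LADDER IN THE DIMENSION BOUND `d`; NOT a statement of the
manuscript. **Γ-FREE GLOBAL ORDER REDUCTION IN DIMENSION `≤ d` at the prime `p`**: for every perfect field `k` of
characteristic `p`, every separated, locally-of-finite-type, quasi-compact, integral, regular `k`-scheme `X` with
`topologicalKrullDim X ≤ d`, every effective Cartier ideal `I ≠ 0` on `X` and every `m ≥ 1`, the input `(X, I, m)` is
order-reducible by permissible blowing-ups (`OrderReducible I m`). Binders byte-identical to the statement of record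
`GammaFreeGlobalOrderReductionDimLeThree p` except `3 ↦ d` (`gammaFreeGlobalOrderReductionDimLE_three_iff`); antitone in
`d` (`GammaFreeGlobalOrderReductionDimLE.of_le`). NAMED RUNGS (typer's RUNG MAP (ii-1)/(ii-2)): `d = 1` regular curves
(res-L1-s46-pv-10), `d = 2` regular surfaces (res-L1-s46-pv-11); `d = 3` = the statement of record. VACUITY: `d = 0` is
the trivially inhabited warm-up slice (integral regular of dimension `0` forces `I = ⊤`), disclosed, not a rung; `d ≥ 1`
contentful; module docstring. [folklore] -/
def GammaFreeGlobalOrderReductionDimLE (p d : ℕ) : Prop :=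
  p.Prime → ∀ (k : Type u) [Field k] [CharP k p] [PerfectField k] (X : Scheme.{u}) (s : X ⟶ Spec (.of k)),
    IsSeparated s → LocallyOfFiniteType s → QuasiCompact s → IsIntegral X → Scheme.IsRegular X →
      topologicalKrullDim X ≤ d → ∀ (I : X.IdealSheafData), I ≠ ⊥ → IsEffectiveCartier I → ∀ (m : ℕ), 1 ≤ m →
        OrderReducible I m

/-- Pure logic: **rung `d = 3` of the ladder IS the statement of record** `GammaFreeGlobalOrderReductionDimLeThree p`
(the numeral `3 : WithBot ℕ∞` is the cast of `3 : ℕ`). [folklore] -/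
theorem gammaFreeGlobalOrderReductionDimLE_three_iff (p : ℕ) :
    GammaFreeGlobalOrderReductionDimLE.{u} p 3 ↔ GammaFreeGlobalOrderReductionDimLeThree.{u} p := by
  simp only [GammaFreeGlobalOrderReductionDimLE, GammaFreeGlobalOrderReductionDimLeThree, OrderReducible, Nat.cast_ofNat]

namespace GammaFreeGlobalOrderReductionDimLE

/-- Pure logic: **the ladder is antitone in the dimension bound** — order reduction in dimension `≤ d′` gives order
reduction in dimension `≤ d` for every `d ≤ d′`. [folklore] -/
theorem of_le {p d d' : ℕ} (hdd : d ≤ d') (h : GammaFreeGlobalOrderReductionDimLE.{u} p d') :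
    GammaFreeGlobalOrderReductionDimLE.{u} p d := by
  intro hp k _ _ _ X s hsep hloft hqc hint hreg hdim I hI hIc m hm
  have hdim' : topologicalKrullDim X ≤ (d' : WithBot ℕ∞) := hdim.trans (by exact_mod_cast hdd)
  exact h hp k X s hsep hloft hqc hint hreg hdim' I hI hIc m hm

/-- Pure logic: any rung `d ≥ 3` of the ladder gives the statement of record. [folklore] -/
theorem gammaFreeGlobalOrderReductionDimLeThree {p d : ℕ} (hd : 3 ≤ d)
    (h : GammaFreeGlobalOrderReductionDimLE.{u} p d) : GammaFreeGlobalOrderReductionDimLeThree.{u} p :=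
  (gammaFreeGlobalOrderReductionDimLE_three_iff p).mp (of_le hd h)

end GammaFreeGlobalOrderReductionDimLE

/-- Pure logic: the statement of record gives every rung `d ≤ 3` (curves, surfaces, threefolds). [folklore] -/
theorem gammaFreeGlobalOrderReductionDimLE_of_dimLeThree {p d : ℕ} (hd : d ≤ 3)
    (h : GammaFreeGlobalOrderReductionDimLeThree.{u} p) : GammaFreeGlobalOrderReductionDimLE.{u} p d :=
  GammaFreeGlobalOrderReductionDimLE.of_le hd ((gammaFreeGlobalOrderReductionDimLE_three_iff p).mpr h)

end CampaignW46

end Summit.ResolutionOfSingularities.ResolutionOfSingularities.Theorems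

end
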